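import Summits.KontsevichZagierPeriods.Zeta5Search.LaiSweepShard

/-!
# `κ₃` sweep certificate — shard file 061 of 127 (shards 427–433 of 889)

HONEST FRAMING. Systematic search; no irrationality claim unless certified. This file only checks,
by `decide +kernel`, shards 427–433 of the order-cell sweep of the `κ₃` point `(74, 2180, 444; δ74)`
(engine `LaiSweepEngine`, soundness `LaiSweepJump/Free/Eval/Shard/Kappa3`; a shard is `⟨regime, n,
p, q, p', q', Lo, Up⟩`: `n` cells from `p/q` to `p'/q'` with integer rate sums in `[Lo, Up]`, `K =
128`, `D = 2^40`). It draws NO conclusion: only the capstone `LaiKappa3SweepCert`, which needs all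
127 shard files, does. Kernel cost of this file ≈ 560 cells × 0.3 s.
-/

namespace Summit.KontsevichZagierPeriods.Zeta5Search.Sweep

set_option maxHeartbeats 100000000 in
/-- Shard 427: 80 cells of regime B from `184/439` to `103/245`.
[cite: Lai2024BallRivoal, §4 Lemma 4.3] -/
theorem shard427 :
    Shard.check 128 (2^40)
      ⟨true, 80, 184, 439, 103, 245, 17383685091503, 19993864718653⟩ = true := by
  decide +kernel

set_option maxHeartbeats 100000000 in
/-- Shard 428: 80 cells of regime B from `103/245` to `183/434`.
[cite: Lai2024BallRivoal, §4 Lemma 4.3] -/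
theorem shard428 :
    Shard.check 128 (2^40)
      ⟨true, 80, 103, 245, 183, 434, 17036097226641, 19610879724357⟩ = true := by
  decide +kernel

set_option maxHeartbeats 100000000 in
/-- Shard 429: 80 cells of regime B from `183/434` to `181/428`.
[cite: Lai2024BallRivoal, §4 Lemma 4.3] -/
theorem shard429 :
    Shard.check 128 (2^40)
      ⟨true, 80, 183, 434, 181, 428, 16824530959617, 19383272943621⟩ = true := by
  decide +kernel

set_option maxHeartbeats 100000000 in
/-- Shard 430: 80 cells of regime B from `181/428` to `137/323`.
[cite: Lai2024BallRivoal, §4 Lemma 4.3] -/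
theorem shard430 :
    Shard.check 128 (2^40)
      ⟨true, 80, 181, 428, 137, 323, 16960562523033, 19556656358105⟩ = true := by
  decide +kernel

set_option maxHeartbeats 100000000 in
/-- Shard 431: 80 cells of regime B from `137/323` to `97/228`.
[cite: Lai2024BallRivoal, §4 Lemma 4.3] -/
theorem shard431 :
    Shard.check 128 (2^40)
      ⟨true, 80, 137, 323, 97, 228, 17443504918757, 20130715138059⟩ = true := by
  decide +kernel

set_option maxHeartbeats 100000000 in
/-- Shard 432: 80 cells of regime B from `97/228` to `131/307`.
[cite: Lai2024BallRivoal, §4 Lemma 4.3] -/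
theorem shard432 :
    Shard.check 128 (2^40)
      ⟨true, 80, 97, 228, 131, 307, 17151133498691, 19810407913717⟩ = true := by
  decide +kernel

set_option maxHeartbeats 100000000 in
/-- Shard 433: 80 cells of regime B from `131/307` to `89/208`.
[cite: Lai2024BallRivoal, §4 Lemma 4.3] -/
theorem shard433 :
    Shard.check 128 (2^40)
      ⟨true, 80, 131, 307, 89, 208, 15802505692757, 18267694755930⟩ = true := by
  decide +kernel

/-- The checked shards of this file, in order. [folklore] -/
def shards061 : List (CheckedShard 128 (2^40)) :=
  [⟨_, shard427⟩, ⟨_, shard428⟩, ⟨_, shard429⟩, ⟨_, shard430⟩, ⟨_, shard431⟩,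
    ⟨_, shard432⟩, ⟨_, shard433⟩]

end Summit.KontsevichZagierPeriods.Zeta5Search.Sweep
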